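import Summits.BirchSwinnertonDyer.BirchSwinnertonDyer.Theorems.ResidualThetaTransportAtTwoSignedMuSeedAtTwoPlusTiltRobertEngine
import HarnessLib

/-!
# The cube root of unity `ζ₃ ∈ ℤ₄ = 𝒪_{ℚ₂(ζ₃)}` and its residue `λ = ζ̄₃ ∈ 𝔽₄ = ℤ₄/(−2)`: `λ² + λ + 1 = 0`
# (discharges the inputs `(hz : z² + z + 1 = 0)` of `Tilt.coeff_hom_tiltCurve_zFour_eq_zero` / `Tilt.coeff_two_homBar_eq_zero` and
# `(hl : l² + l + 1 = 0)` of the Robert-factor files on the engine's objects; seed line `norm-field-tilt`, crux `SignedMuSeedAtTwoPlus`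
# stmt-BirchSwinnertonDyer-21438; Kμ⁺ stmt-BirchSwinnertonDyer-20689)

Cell `bsd-wall`, width seat `bsd-wall-rtt-p4-w2` g14 (`--supports`, closes nothing).  THEOREMS ONLY; BSD is not proved by this.

* `norm_zeta_eq_one` — `‖ζ‖ = 1` for `ζ² + ζ + 1 = 0` in `ℚ̄₂` (`ζ³ = 1`);
* **`exists_rho_unitBall`** — `∃ z ∈ 𝒪 = LubinTate.unitBall ℚ_[2]⟮ζ⟯` with `z * z + z + 1 = 0` (namely `ζ`);
* **`exists_rho_residue`** — `∃ l ∈ 𝒪/(−2)` with `l ^ 2 + l + 1 = 0` (namely `ζ̄`): the weight `λ` of the diagonal `ρ`-symmetrisation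
  `S₀ = λΦ(λt) + λ²Φ(λ²t)` EXISTS in the engine's residue field. [folklore]
-/

set_option autoImplicit false
-- the Theorems namespace of this sub repeats the summit name by design (D-0017 nested layout)
set_option linter.dupNamespace false

noncomputable section

open scoped Classical IntermediateField
open PowerSeries
open Literature.NumberTheory.GaloisRepresentations
open Summit.BirchSwinnertonDyer.BirchSwinnertonDyer.Theorems.RelativeLubinTate.ZFour
open Summit.BirchSwinnertonDyer.BirchSwinnertonDyer.Theorems.SignedMuAtTwo.JetCharacterSums

namespace Summit.BirchSwinnertonDyer.BirchSwinnertonDyer.Theorems.SignedMuAtTwo.Tilt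

variable {ζ : PadicAlgCl 2} (hζ : ζ ^ 2 + ζ + 1 = 0)

include hζ in
/-- `‖ζ‖ = 1` in `ℚ̄₂` for a primitive cube root of unity (`ζ³ = 1`). [folklore] -/
theorem norm_zeta_eq_one : ‖ζ‖ = 1 := by
  have h3 : ζ ^ 3 = 1 := pow_three_eq_one_of_rho hζ
  have h : ‖ζ‖ ^ 3 = 1 := by rw [← norm_pow, h3, norm_one]
  exact (pow_eq_one_iff_of_nonneg (norm_nonneg ζ) (by norm_num)).mp h

include hζ in
/-- **`ζ₃ ∈ ℤ₄ = 𝒪_{ℚ₂(ζ₃)}` is a primitive cube root of unity there**: `∃ z ∈ 𝒪`, `z·z + z + 1 = 0` — the input `hz`/`hρ` of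
`Tilt.coeff_hom_tiltCurve_zFour_eq_zero`, `Tilt.coeff_two_homBar_eq_zero`. [folklore] -/
theorem exists_rho_unitBall : ∃ z : LubinTate.unitBall (↥ℚ_[2]⟮ζ⟯), z * z + z + 1 = 0 := by
  have hmem : ζ ∈ ℚ_[2]⟮ζ⟯ := IntermediateField.mem_adjoin_simple_self ℚ_[2] ζ
  have hn : ‖(⟨ζ, hmem⟩ : ↥ℚ_[2]⟮ζ⟯)‖ ≤ 1 := by rw [norm_coe_adjoin]; exact (norm_zeta_eq_one hζ).le
  refine ⟨⟨⟨ζ, hmem⟩, (LubinTate.mem_unitBall_iff _).mpr hn⟩, ?_⟩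
  apply Subtype.ext
  apply Subtype.ext
  change ζ * ζ + ζ + 1 = 0
  linear_combination hζ

include hζ in
/-- **`∃ λ ∈ 𝔽₄ = ℤ₄/(−2)` with `λ² + λ + 1 = 0`** (the residue of `ζ₃`): the weight of the diagonal `ρ`-symmetrisation exists in the engine's
residue ring — the hypothesis `hl` of `Tilt.nonDeg_one_robertSum_homBar`, `Tilt.oddDigit_of_robertFactor_tiltCurve`, … is inhabited. [folklore] -/
theorem exists_rho_residue :
    ∃ l : LubinTate.unitBall (↥ℚ_[2]⟮ζ⟯) ⧸ Ideal.span {-((2 : ℕ) : LubinTate.unitBall (↥ℚ_[2]⟮ζ⟯))}, l ^ 2 + l + 1 = 0 := by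
  obtain ⟨z, hz⟩ := exists_rho_unitBall hζ
  set q := Ideal.Quotient.mk (Ideal.span {-((2 : ℕ) : LubinTate.unitBall (↥ℚ_[2]⟮ζ⟯))}) with hq
  refine ⟨q z, ?_⟩
  -- term-mode transport (no rewriting under the `ℤ₄`-quotient types)
  have e : q (z * z + z + 1) = q z * q z + q z + 1 :=
    (map_add q (z * z + z) 1).trans
      (congrArg₂ (· + ·) ((map_add q (z * z) z).trans (congrArg₂ (· + ·) (map_mul q z z) rfl)) (map_one q))
  have e' : q z ^ 2 + q z + 1 = q (z * z + z + 1) :=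
    (congrArg₂ (· + ·) (congrArg₂ (· + ·) (sq (q z)) rfl) rfl).trans e.symm
  exact e'.trans ((congrArg q hz).trans (map_zero q))

end Summit.BirchSwinnertonDyer.BirchSwinnertonDyer.Theorems.SignedMuAtTwo.Tilt

end
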